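import Mathlib.Analysis.SpecialFunctions.Pow.Real

/-!
# EriceRemainderEnclosureHistoryAutonomyComparisonAgeCompositionShareAlgebra — (E90a) route (N), first order: THE PURE ALGEBRA OF WINDOW SHARES — two shares on the
# hyperbola `(1−s)(1−s') = c²ss'` sum to at most `2∕(1+c)`; three shares under a Markov (AR(1)) correlation matrix `(a, ab, b)` sum to at most
# `(3+a+b−ab)∕((1+a)(1+b)) ≤ (3−√(ab))∕(1+√(ab))` (a sum-of-squares identity); the numerics `(3−t)∕(1+t) ≤ √2` for `t⁸ ≥ 2∕57` and
# `(3−2√2)²(i+j)² ≤ 4ij` for `j ≤ 133i`; and the two assembled cores used along flows by (E90c): TWO LOADS `x + x' ≤ 1` from two weighted shares,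
# THREE SHARES `≤ √2` under a sub-Markov kernel

Cell `pub-balaban`, β-function sub-cell, BINDER row D4 «RemainderConst leaves for Bałaban's split» (`HOME/BINDER-OWNERS.md`; owner lineage `b2b-balaban-beta-an4`;
this file by co-owner #2 lineage `b2b-balaban-beta-d4-p2`, generation 81), β-FLOW TEAM duty (1), FREEZE (0) honoured (def-free; nothing restated).

HONEST FRAMING (page 1, verbatim and binding).  *"Discharging BetaPertH makes Bałaban's UV stability UNCONDITIONAL — a real constructive-QFT result; it is
NOT the continuum limit and NOT the Clay problem."*  THIS FILE DISCHARGES NOTHING OF THE KIND.  Elementary real algebra ∕ real analysis about ABSTRACT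
functionals on a box ]0,γ]^ℕ with displayed floors, profiles and signs, and the FIRST-ORDER renewal objects of route (N) built from them — hypotheses of a
census, not facts; the form, signs, ages and moments of Bałaban's (1.22) limit functional are NOT PRINTED ([I] p. 298; GAPS G-t4-U2-1∕-2) and NOT asserted.
Row D4 class UNCHANGED (critical-path width 0; instance 0∕1; D4 DISCHARGE NO DATE).  HONEST DEPENDENCY: continuum YM on T⁴ ⇐ BetaPertH ∧ nine spine
estimates (0/9 proved); BetaPertH ⇐ (D1) ∧ (D4) ∧ CAP+tail; G-an2-4 gates asym, D1 and NE2/3/4.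

THE POINT (README `HOME/b2b-balaban-beta-d4-p2/g81/e90/README.md` §2).  Generation 80 reduced the three-age END along flows to ONE inequality, the total
undamped window load `d_m + x₂(m) + x₃(m) ≤ 1` at every pin ((E89b) `flow_nonneg_three_ages_of_window_loads`), true on the whole census with margin but
unproved.  Generation 81 proves it for `k₃ ≤ 56` (and the two-age total for `j ≤ 133·i`) through the SHARE FUNCTIONAL: the own-window usage of an age is
at most its SHARE `s_i = L_ih_{2n_i}∕Σ_j L_jh_{n_i+n_j}` of the reads of its own window — a quantity in which the rises `1∕h² − 1∕h²` no longer appear —,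
and the shares of different ages are coupled EXACTLY through the "correlations" `C_{ij} = h_{n_i+n_j}∕√(h_{2n_i}h_{2n_j}) ∈ ]0,1]` of the log-convex
level sequence: two shares lie on the hyperbola `(1−s_i)(1−s_j) = C_{ij}²s_is_j`, three shares are dominated by the shares of the MARKOV matrix
`(C₁₂, C₁₃, C₁₃∕C₁₂)` because `C₁₃ ≤ C₁₂C₂₃` (sub-Markov = four-point log-convexity).  This file is the flow-free algebra of that argument; (E90b)
`…AgeCompositionWindowShares` supplies the flow geometry (strict log-convexity of the levels, the shared window, load ≤ share), (E90c)
`…AgeCompositionThreeAgesTotalLoad` the theorems along flows and the END.  NOT CLAIMED: anything for `k₃ > 56` ∕ `j > 133i` (the share route with unit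
weights stops there; README §4 lists the measured thresholds: `Ψ₃` 64, W3-LP ≈ 450, full LP ≈ 5·10³); anything printed — NOT B12 Thm 2, NOT BetaPertH.

WHAT IS PROVED ([folklore]; 0 `def`, 0 sorry).  §1 `two_shares_le`, `three_shares_markov_le`, `markov_bound_le`, `three_minus_div_le_sqrt_two`,
`two_ages_numerics`; §2 `pair_le_one_of_shares`, `comb_pos`, `three_shares_le_sqrt_two`.
-/
noncomputable section

namespace Summit.QuantumFields.BalabanUV.Beta.EriceRemainderEnclosureHistoryAutonomyComparisonAgeCompositionShareAlgebra

/-! ## §1 Pure share algebra -/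

/-- **TWO SHARES ON A HYPERBOLA.**  If `X, Y ≤ 1` satisfy `c²·XY ≤ (1−X)(1−Y)` with `0 ≤ c ≤ 1`, then `(1+c)(X+Y) ≤ 2`. [folklore] -/
theorem two_shares_le {c X Y : ℝ} (hc0 : 0 ≤ c) (hc1 : c ≤ 1) (hX1 : X ≤ 1) (hY1 : Y ≤ 1)
    (hXY : c ^ 2 * (X * Y) ≤ (1 - X) * (1 - Y)) : (1 + c) * (X + Y) ≤ 2 := by
  rcases hc0.eq_or_lt with rfl | hc
  · linarith
  by_contra hgt
  have hB : 0 < (1 + c) * (X + Y) - 2 := by linarith [not_le.mp hgt]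
  have hA : 0 < 2 - (1 - c) * (X + Y) := by nlinarith
  -- ((1+c)σ − 2)((1−c)σ − 2) = (1−c²)σ² − 4σ + 4 ≥ 0 from the hypothesis, XY ≤ σ²∕4 and c ≤ 1
  have hkey : 0 ≤ ((1 + c) * (X + Y) - 2) * ((1 - c) * (X + Y) - 2) := by
    nlinarith [sq_nonneg (X - Y), mul_nonneg (sub_nonneg.2 hc1) (add_nonneg hc0 (le_of_lt hc))]
  nlinarith [mul_pos hB hA]

/-- **THREE SHARES UNDER A MARKOV (AR(1)) CORRELATION MATRIX.**  For `p, q, r ≥ 0` not all zero and `0 < a < 1`, `0 < b < 1`: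
`p∕(p + a·q + ab·r) + q∕(a·p + q + b·r) + r∕(ab·p + b·q + r) ≤ (3 + a + b − ab)∕((1+a)(1+b))`; the difference is the sum of squares
`a(β₁−β₂)²∕((1−a²)β₁β₂) + b(β₂−β₃)²∕((1−b²)β₂β₃)` in the three denominators `β`. [folklore] -/
theorem three_shares_markov_le {a b p q r : ℝ} (ha0 : 0 < a) (ha1 : a < 1) (hb0 : 0 < b) (hb1 : b < 1)
    (hp : 0 ≤ p) (hq : 0 ≤ q) (hr : 0 ≤ r) (hpqr : 0 < p + q + r) :
    p / (p + a * q + a * b * r) + q / (a * p + q + b * r) + r / (a * b * p + b * q + r) ≤ (3 + a + b - a * b) / ((1 + a) * (1 + b)) := by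
  have hab : 0 < a * b := mul_pos ha0 hb0
  have hab1 : a * b < 1 := by nlinarith
  -- the three denominators ("window reads") are positive
  have h1 : 0 < p + a * q + a * b * r := by nlinarith [mul_nonneg hab.le hp, mul_nonneg hab.le hq, mul_nonneg ha0.le hq]
  have h2 : 0 < a * p + q + b * r := by nlinarith [mul_nonneg hab.le hp, mul_nonneg hab.le hq, mul_nonneg hab.le hr, mul_nonneg hb0.le hr]
  have h3 : 0 < a * b * p + b * q + r := by nlinarith [mul_nonneg hab.le hq, mul_nonneg hab.le hr, mul_nonneg hb0.le hq]
  obtain ⟨β₁, hβ₁⟩ : ∃ x : ℝ, x = p + a * q + a * b * r := ⟨_, rfl⟩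
  obtain ⟨β₂, hβ₂⟩ : ∃ x : ℝ, x = a * p + q + b * r := ⟨_, rfl⟩
  obtain ⟨β₃, hβ₃⟩ : ∃ x : ℝ, x = a * b * p + b * q + r := ⟨_, rfl⟩
  rw [← hβ₁, ← hβ₂, ← hβ₃]
  rw [← hβ₁] at h1; rw [← hβ₂] at h2; rw [← hβ₃] at h3
  -- the sum-of-squares identity behind the bound, denominators cleared
  have key : (1 - a) * (1 - b) * ((3 + a + b - a * b) * (β₁ * β₂ * β₃) - (p * (β₂ * β₃) + q * (β₁ * β₃) + r * (β₁ * β₂)) * ((1 + a) * (1 + b)))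
      = (1 - b ^ 2) * a * β₃ * (β₁ - β₂) ^ 2 + (1 - a ^ 2) * b * β₁ * (β₂ - β₃) ^ 2 := by
    subst hβ₁ hβ₂ hβ₃; ring
  have hsos : 0 ≤ (1 - b ^ 2) * a * β₃ * (β₁ - β₂) ^ 2 + (1 - a ^ 2) * b * β₁ * (β₂ - β₃) ^ 2 := by
    have : 0 < 1 - a ^ 2 := by nlinarith
    have : 0 < 1 - b ^ 2 := by nlinarith
    positivity
  have hD : 0 ≤ (3 + a + b - a * b) * (β₁ * β₂ * β₃) - (p * (β₂ * β₃) + q * (β₁ * β₃) + r * (β₁ * β₂)) * ((1 + a) * (1 + b)) :=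
    (mul_nonneg_iff_of_pos_left (mul_pos (by linarith : (0:ℝ) < 1 - a) (by linarith : (0:ℝ) < 1 - b))).mp (key ▸ hsos)
  have e : p / β₁ + q / β₂ + r / β₃ = (p * (β₂ * β₃) + q * (β₁ * β₃) + r * (β₁ * β₂)) / (β₁ * β₂ * β₃) := by
    rw [div_add_div _ _ h1.ne' h2.ne', div_add_div _ _ (mul_pos h1 h2).ne' h3.ne']
    congr 1; ring
  rw [e, div_le_div_iff₀ (by positivity) (by positivity)]
  exact sub_nonneg.mp hD

/-- The Markov bound is at most `(3 − t)∕(1 + t)` for `t = √(ab) ≤ 1`: `(1+a)(1+b) ≥ (1+√(ab))²`. [folklore] -/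
theorem markov_bound_le {a b t : ℝ} (ha0 : 0 ≤ a) (hb0 : 0 ≤ b) (ht0 : 0 ≤ t) (ht1 : t ≤ 1) (ht : t ^ 2 = a * b) :
    (3 + a + b - a * b) / ((1 + a) * (1 + b)) ≤ (3 - t) / (1 + t) := by
  have hden : 0 < (1 + a) * (1 + b) := by positivity
  have ht1' : 0 < 1 + t := by positivity
  rw [div_le_div_iff₀ hden ht1']
  have hte : t = Real.sqrt a * Real.sqrt b := by
    rw [← Real.sqrt_mul ha0, ← ht, Real.sqrt_sq ht0]
  have hamgm : 2 * t ≤ a + b := by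
    have ha := Real.sq_sqrt ha0; have hb := Real.sq_sqrt hb0
    nlinarith [sq_nonneg (Real.sqrt a - Real.sqrt b)]
  -- (3 − t)(1+a)(1+b) − (3 + a + b − ab)(1 + t) = 2(1 − t)(a + b − 2t)
  nlinarith [mul_nonneg (sub_nonneg.2 ht1) (sub_nonneg.2 hamgm)]

/-- Numerics: if `t ≥ 0` and `t⁸ ≥ 2∕57` then `(3 − t)∕(1 + t) ≤ √2`. [folklore] -/
theorem three_minus_div_le_sqrt_two {t : ℝ} (ht0 : 0 ≤ t) (ht8 : 2 / 57 ≤ t ^ 8) : (3 - t) / (1 + t) ≤ Real.sqrt 2 := by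
  have ht : (0.65787 : ℝ) ≤ t := by
    by_contra hlt
    have hlt' := not_le.mp hlt
    have : t ^ 8 < (0.65787 : ℝ) ^ 8 := pow_lt_pow_left₀ hlt' ht0 (by norm_num)
    norm_num at this
    linarith
  have hs : (1.41421 : ℝ) ≤ Real.sqrt 2 := by
    rw [Real.le_sqrt (by norm_num) (by norm_num)]; norm_num
  rw [div_le_iff₀ (by positivity)]
  nlinarith

/-- Numerics: `(3 − 2√2)²·(i + j)² ≤ 4·i·j` whenever `0 < i ≤ j ≤ 133·i`. [folklore] -/
theorem two_ages_numerics {i j : ℝ} (hi : 0 < i) (hij : i ≤ j) (hj : j ≤ 133 * i) :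
    (3 - 2 * Real.sqrt 2) ^ 2 * (i + j) ^ 2 ≤ 4 * i * j := by
  have hs : (1.41421 : ℝ) ≤ Real.sqrt 2 := by
    rw [Real.le_sqrt (by norm_num) (by norm_num)]; norm_num
  have hs' : Real.sqrt 2 ≤ 1.5 := by
    rw [Real.sqrt_le_left (by norm_num)]; norm_num
  have hc : (3 - 2 * Real.sqrt 2) ^ 2 ≤ 0.02948 := by nlinarith
  have hq : (i + j) ^ 2 ≤ 135.0076 * (i * j) := by nlinarith [mul_nonneg (sub_nonneg.2 hj) (sub_nonneg.2 hij)]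
  have hij0 : 0 ≤ i * j := by nlinarith
  nlinarith [mul_le_mul hc hq (sq_nonneg _) (by norm_num)]


/-! ## §2 The assembled pure cores: two loads from two weighted shares, three shares under a sub-Markov kernel -/

/-- **TWO LOADS FROM TWO SHARES.**  If `√2·x ≤ P·s`, `√2·x' ≤ P'·s'` with `P, P' ∈ [0,1]`, shares `s, s' ≤ 1` on the hyperbola
`(1−s)(1−s')·w = ρ·(s s')·w`-free form `(1 − s)(1 − s') = ρ·(s·s')`, and `(√2−1)²·P·P' ≤ ρ`, then `x + x' ≤ 1`. [folklore] -/
theorem pair_le_one_of_shares {x x' s s' P P' ρ : ℝ} (hx : 0 ≤ x) (hx' : 0 ≤ x') (hP1 : P ≤ 1) (hP1' : P' ≤ 1)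
    (hs0 : 0 ≤ s) (hs1 : s ≤ 1) (hs0' : 0 ≤ s') (hs1' : s' ≤ 1) (hxs : Real.sqrt 2 * x ≤ P * s) (hxs' : Real.sqrt 2 * x' ≤ P' * s')
    (hhyp : (1 - s) * (1 - s') = ρ * (s * s')) (hρ : (Real.sqrt 2 - 1) ^ 2 * (P * P') ≤ ρ) : x + x' ≤ 1 := by
  have hs2 : Real.sqrt 2 ^ 2 = 2 := Real.sq_sqrt (by norm_num)
  have hs1le : (1 : ℝ) ≤ Real.sqrt 2 := by rw [Real.le_sqrt (by norm_num) (by norm_num)]; norm_num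
  have hsle2 : Real.sqrt 2 ≤ 2 := by rw [Real.sqrt_le_left (by norm_num)]; norm_num
  set X := Real.sqrt 2 * x with hX
  set Y := Real.sqrt 2 * x' with hY
  have hX0 : 0 ≤ X := by positivity
  have hY0 : 0 ≤ Y := by positivity
  have hXs : X ≤ s := hxs.trans (by nlinarith [mul_le_mul_of_nonneg_right hP1 hs0])
  have hYs : Y ≤ s' := hxs'.trans (by nlinarith [mul_le_mul_of_nonneg_right hP1' hs0'])
  have hkey : (Real.sqrt 2 - 1) ^ 2 * (X * Y) ≤ (1 - X) * (1 - Y) := by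
    have h1 : (1 - s) * (1 - s') ≤ (1 - X) * (1 - Y) := mul_le_mul (by linarith) (by linarith) (by linarith) (by linarith)
    have h2 : X * Y ≤ (P * P') * (s * s') := by
      have := mul_le_mul hxs hxs' (by positivity) (by nlinarith); linarith [this]
    have h3 : (Real.sqrt 2 - 1) ^ 2 * (X * Y) ≤ ρ * (s * s') := by
      calc (Real.sqrt 2 - 1) ^ 2 * (X * Y) ≤ (Real.sqrt 2 - 1) ^ 2 * ((P * P') * (s * s')) := mul_le_mul_of_nonneg_left h2 (sq_nonneg _)
        _ = ((Real.sqrt 2 - 1) ^ 2 * (P * P')) * (s * s') := by ring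
        _ ≤ ρ * (s * s') := mul_le_mul_of_nonneg_right hρ (by nlinarith)
    linarith
  have htwo := two_shares_le (c := Real.sqrt 2 - 1) (by linarith) (by linarith) (hXs.trans hs1) (hYs.trans hs1') hkey
  -- (1 + (√2 − 1))·(X + Y) = 2(x + x')
  nlinarith

/-- A positive combination of three non-negative loads, not all zero, is positive. [folklore] -/
theorem comb_pos {l₁ l₂ l₃ u v w : ℝ} (hl₁ : 0 ≤ l₁) (hl₂ : 0 ≤ l₂) (hl₃ : 0 ≤ l₃) (hl : 0 < l₁ + l₂ + l₃) (hu : 0 < u) (hv : 0 < v)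
    (hw : 0 < w) : 0 < l₁ * u + l₂ * v + l₃ * w := by
  rcases lt_or_eq_of_le hl₁ with h1 | h1
  · nlinarith [mul_nonneg hl₂ hv.le, mul_nonneg hl₃ hw.le, mul_pos h1 hu]
  · rcases lt_or_eq_of_le hl₂ with h2 | h2
    · nlinarith [mul_nonneg hl₃ hw.le, mul_pos h2 hv]
    · have h3 : 0 < l₃ := by linarith
      rw [← h1, ← h2]; nlinarith [mul_pos h3 hw]

/-- **THREE SHARES UNDER A SUB-MARKOV KERNEL.**  Loads `ℓ ≥ 0` not all zero, a positive kernel `g_{ij}` (the levels `h(m+n_i+n_j)`) strictly log-convex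
on the two consecutive pairs (`g₁₂² < g₁₁g₂₂`, `g₂₃² < g₂₂g₃₃`), SUB-MARKOV across the middle age (`g₁₃g₂₂ ≤ g₁₂g₂₃`), and with `g₁₃⁴ ≥ (2∕57)·g₁₁²g₃₃²`:
the three self-shares `ℓ_i g_{ii}∕Σ_j ℓ_j g_{ij}` sum to at most `√2` (comparison with the Markov matrix `(C₁₂, C₁₃, C₁₃∕C₁₂)`, §1). [folklore] -/
theorem three_shares_le_sqrt_two {l₁ l₂ l₃ g₁₁ g₁₂ g₁₃ g₂₂ g₂₃ g₃₃ : ℝ} (hl₁ : 0 ≤ l₁) (hl₂ : 0 ≤ l₂) (hl₃ : 0 ≤ l₃) (hl : 0 < l₁ + l₂ + l₃)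
    (h11 : 0 < g₁₁) (h12 : 0 < g₁₂) (h13 : 0 < g₁₃) (h22 : 0 < g₂₂) (h23 : 0 < g₂₃) (h33 : 0 < g₃₃)
    (hlc12 : g₁₂ ^ 2 < g₁₁ * g₂₂) (hlc23 : g₂₃ ^ 2 < g₂₂ * g₃₃) (hsub : g₁₃ * g₂₂ ≤ g₁₂ * g₂₃)
    (ht8 : 2 / 57 * (g₁₁ ^ 2 * g₃₃ ^ 2) ≤ g₁₃ ^ 4) :
    l₁ * g₁₁ / (l₁ * g₁₁ + l₂ * g₁₂ + l₃ * g₁₃) + l₂ * g₂₂ / (l₁ * g₁₂ + l₂ * g₂₂ + l₃ * g₂₃) + l₃ * g₃₃ / (l₁ * g₁₃ + l₂ * g₂₃ + l₃ * g₃₃)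
      ≤ Real.sqrt 2 := by
  -- square roots of the diagonal
  obtain ⟨η₁, hη₁⟩ : ∃ x : ℝ, x = Real.sqrt g₁₁ := ⟨_, rfl⟩
  obtain ⟨η₂, hη₂⟩ : ∃ x : ℝ, x = Real.sqrt g₂₂ := ⟨_, rfl⟩
  obtain ⟨η₃, hη₃⟩ : ∃ x : ℝ, x = Real.sqrt g₃₃ := ⟨_, rfl⟩
  have hη₁0 : 0 < η₁ := by rw [hη₁]; exact Real.sqrt_pos.2 h11
  have hη₂0 : 0 < η₂ := by rw [hη₂]; exact Real.sqrt_pos.2 h22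
  have hη₃0 : 0 < η₃ := by rw [hη₃]; exact Real.sqrt_pos.2 h33
  have hη₁2 : η₁ ^ 2 = g₁₁ := by rw [hη₁]; exact Real.sq_sqrt h11.le
  have hη₂2 : η₂ ^ 2 = g₂₂ := by rw [hη₂]; exact Real.sq_sqrt h22.le
  have hη₃2 : η₃ ^ 2 = g₃₃ := by rw [hη₃]; exact Real.sq_sqrt h33.le
  -- the Markov parameters a = C₁₂ and c = C₁₃∕C₁₂
  obtain ⟨a, ha⟩ : ∃ x : ℝ, x = g₁₂ / (η₁ * η₂) := ⟨_, rfl⟩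
  obtain ⟨c, hc⟩ : ∃ x : ℝ, x = g₁₃ * η₂ / (g₁₂ * η₃) := ⟨_, rfl⟩
  have ha0 : 0 < a := by rw [ha]; positivity
  have hc0 : 0 < c := by rw [hc]; positivity
  have ha2 : a ^ 2 = g₁₂ ^ 2 / (g₁₁ * g₂₂) := by rw [ha, div_pow, mul_pow, hη₁2, hη₂2]
  have ha1 : a < 1 := by
    have : a ^ 2 < 1 := by rw [ha2, div_lt_one (by positivity)]; exact hlc12
    exact (pow_lt_one_iff_of_nonneg ha0.le two_ne_zero).mp this
  have hc2 : c ^ 2 = g₁₃ ^ 2 * g₂₂ / (g₁₂ ^ 2 * g₃₃) := by rw [hc, div_pow, mul_pow, mul_pow, hη₂2, hη₃2]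
  have hc1 : c < 1 := by
    have hnum : g₁₃ ^ 2 * g₂₂ < g₁₂ ^ 2 * g₃₃ := by
      have h1 : (g₁₃ * g₂₂) ^ 2 ≤ (g₁₂ * g₂₃) ^ 2 := pow_le_pow_left₀ (by positivity) hsub 2
      have h2 : g₁₃ ^ 2 * g₂₂ * g₂₂ < g₁₂ ^ 2 * g₃₃ * g₂₂ := calc
        g₁₃ ^ 2 * g₂₂ * g₂₂ = (g₁₃ * g₂₂) ^ 2 := by ring
        _ ≤ (g₁₂ * g₂₃) ^ 2 := h1
        _ = g₁₂ ^ 2 * g₂₃ ^ 2 := by ring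
        _ < g₁₂ ^ 2 * (g₂₂ * g₃₃) := mul_lt_mul_of_pos_left hlc23 (by positivity)
        _ = g₁₂ ^ 2 * g₃₃ * g₂₂ := by ring
      exact lt_of_mul_lt_mul_right h2 h22.le
    have : c ^ 2 < 1 := by rw [hc2, div_lt_one (by positivity)]; exact hnum
    exact (pow_lt_one_iff_of_nonneg hc0.le two_ne_zero).mp this
  have hac : a * c = g₁₃ / (η₁ * η₃) := by
    rw [ha, hc]; field_simp
  -- the normalised loads p = ℓ₁η₁, q = ℓ₂η₂, r = ℓ₃η₃ and the Markov bound
  have hpqr : 0 < l₁ * η₁ + l₂ * η₂ + l₃ * η₃ := comb_pos hl₁ hl₂ hl₃ hl hη₁0 hη₂0 hη₃0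
  have hM := three_shares_markov_le ha0 ha1 hc0 hc1 (mul_nonneg hl₁ hη₁0.le) (mul_nonneg hl₂ hη₂0.le) (mul_nonneg hl₃ hη₃0.le) hpqr
  -- the three Markov denominators versus the window reads (equality, sub-Markov, sub-Markov)
  have hD₁ : l₁ * η₁ + a * (l₂ * η₂) + a * c * (l₃ * η₃) = (l₁ * g₁₁ + l₂ * g₁₂ + l₃ * g₁₃) / η₁ := by
    rw [hac, ha, ← hη₁2]; field_simp
  have hsub' : g₁₃ * g₂₂ / g₁₂ ≤ g₂₃ := by rw [div_le_iff₀ h12]; linarith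
  have hbr : c * (l₃ * η₃) ≤ l₃ * g₂₃ / η₂ := by
    rw [hc, le_div_iff₀ hη₂0]
    have e : g₁₃ * η₂ / (g₁₂ * η₃) * (l₃ * η₃) * η₂ = l₃ * (g₁₃ * g₂₂ / g₁₂) := by rw [← hη₂2]; field_simp
    rw [e]
    exact mul_le_mul_of_nonneg_left hsub' hl₃
  have hbq : c * (l₂ * η₂) ≤ l₂ * g₂₃ / η₃ := by
    rw [hc, le_div_iff₀ hη₃0]
    have e : g₁₃ * η₂ / (g₁₂ * η₃) * (l₂ * η₂) * η₃ = l₂ * (g₁₃ * g₂₂ / g₁₂) := by rw [← hη₂2]; field_simp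
    rw [e]
    exact mul_le_mul_of_nonneg_left hsub' hl₂
  have hD₂ : a * (l₁ * η₁) + l₂ * η₂ + c * (l₃ * η₃) ≤ (l₁ * g₁₂ + l₂ * g₂₂ + l₃ * g₂₃) / η₂ := by
    have e : (l₁ * g₁₂ + l₂ * g₂₂ + l₃ * g₂₃) / η₂ = a * (l₁ * η₁) + l₂ * η₂ + l₃ * g₂₃ / η₂ := by
      rw [ha, ← hη₂2]; field_simp
    rw [e]; linarith
  have hD₃ : a * c * (l₁ * η₁) + c * (l₂ * η₂) + l₃ * η₃ ≤ (l₁ * g₁₃ + l₂ * g₂₃ + l₃ * g₃₃) / η₃ := by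
    have e : (l₁ * g₁₃ + l₂ * g₂₃ + l₃ * g₃₃) / η₃ = a * c * (l₁ * η₁) + l₂ * g₂₃ / η₃ + l₃ * η₃ := by
      rw [hac, ← hη₃2]; field_simp
    rw [e]; linarith
  -- positivity of all denominators
  have hD1pos : 0 < l₁ * g₁₁ + l₂ * g₁₂ + l₃ * g₁₃ := comb_pos hl₁ hl₂ hl₃ hl h11 h12 h13
  have hD2pos : 0 < l₁ * g₁₂ + l₂ * g₂₂ + l₃ * g₂₃ := comb_pos hl₁ hl₂ hl₃ hl h12 h22 h23
  have hD3pos : 0 < l₁ * g₁₃ + l₂ * g₂₃ + l₃ * g₃₃ := comb_pos hl₁ hl₂ hl₃ hl h13 h23 h33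
  have hden₂ : 0 < a * (l₁ * η₁) + l₂ * η₂ + c * (l₃ * η₃) := by
    have := comb_pos hl₁ hl₂ hl₃ hl (mul_pos ha0 hη₁0) hη₂0 (mul_pos hc0 hη₃0); linarith
  have hden₃ : 0 < a * c * (l₁ * η₁) + c * (l₂ * η₂) + l₃ * η₃ := by
    have := comb_pos hl₁ hl₂ hl₃ hl (mul_pos (mul_pos ha0 hc0) hη₁0) (mul_pos hc0 hη₂0) hη₃0; linarith
  -- term by term: the actual shares are at most the Markov shares
  have ht₁ : l₁ * g₁₁ / (l₁ * g₁₁ + l₂ * g₁₂ + l₃ * g₁₃) = l₁ * η₁ / (l₁ * η₁ + a * (l₂ * η₂) + a * c * (l₃ * η₃)) := by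
    rw [hD₁, ← hη₁2]; field_simp
  have ht₂ : l₂ * g₂₂ / (l₁ * g₁₂ + l₂ * g₂₂ + l₃ * g₂₃) ≤ l₂ * η₂ / (a * (l₁ * η₁) + l₂ * η₂ + c * (l₃ * η₃)) := by
    have e : l₂ * g₂₂ / (l₁ * g₁₂ + l₂ * g₂₂ + l₃ * g₂₃) = l₂ * η₂ / ((l₁ * g₁₂ + l₂ * g₂₂ + l₃ * g₂₃) / η₂) := by
      rw [← hη₂2]; field_simp
    rw [e]
    exact div_le_div_of_nonneg_left (mul_nonneg hl₂ hη₂0.le) hden₂ hD₂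
  have ht₃ : l₃ * g₃₃ / (l₁ * g₁₃ + l₂ * g₂₃ + l₃ * g₃₃) ≤ l₃ * η₃ / (a * c * (l₁ * η₁) + c * (l₂ * η₂) + l₃ * η₃) := by
    have e : l₃ * g₃₃ / (l₁ * g₁₃ + l₂ * g₂₃ + l₃ * g₃₃) = l₃ * η₃ / ((l₁ * g₁₃ + l₂ * g₂₃ + l₃ * g₃₃) / η₃) := by
      rw [← hη₃2]; field_simp
    rw [e]
    exact div_le_div_of_nonneg_left (mul_nonneg hl₃ hη₃0.le) hden₃ hD₃
  -- the Markov value is at most (3 − t)∕(1 + t) ≤ √2, t = √(ac) = C₁₃^{1∕2}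
  obtain ⟨t, ht⟩ : ∃ x : ℝ, x = Real.sqrt (a * c) := ⟨_, rfl⟩
  have ht0 : 0 ≤ t := by rw [ht]; exact Real.sqrt_nonneg _
  have ht2 : t ^ 2 = a * c := by rw [ht]; exact Real.sq_sqrt (mul_pos ha0 hc0).le
  have hac1 : a * c < 1 := by have := mul_lt_mul'' ha1 hc1 ha0.le hc0.le; simpa using this
  have ht1 : t ≤ 1 := (pow_le_one_iff_of_nonneg ht0 two_ne_zero).mp (by rw [ht2]; exact hac1.le)
  have ht8' : 2 / 57 ≤ t ^ 8 := by
    have e8 : t ^ 8 = (a * c) ^ 4 := by rw [show (8 : ℕ) = 2 * 4 by norm_num, pow_mul, ht2]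
    rw [e8, hac, div_pow, mul_pow, show η₁ ^ 4 = (η₁ ^ 2) ^ 2 by ring, show η₃ ^ 4 = (η₃ ^ 2) ^ 2 by ring, hη₁2, hη₃2,
      le_div_iff₀ (by positivity)]
    linarith
  have hMB := markov_bound_le ha0.le hc0.le ht0 ht1 ht2
  have hfin := three_minus_div_le_sqrt_two ht0 ht8'
  rw [ht₁]
  linarith

end Summit.QuantumFields.BalabanUV.Beta.EriceRemainderEnclosureHistoryAutonomyComparisonAgeCompositionShareAlgebra

end
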